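import Summits.FinalStateConjecture.FinalStateConjecture.Theorems.PhotonSphereChannelsKerrDevDefs
import HarnessLib

/-!
# Route PhotonSphereChannels · crux `ChannelsResolveTameDevelopmentsR` (K2R, stmt-FinalStateConjecture-14075) — the
# intermediate-value shell of stub S5 `stub_hullConnectedness` (line `kerr-isolation-dichotomy`, lead c2; stub-worker S5)

Stub S5 of the skeleton `Cruxes/ChannelsResolveTameDevelopmentsR/Lines/kerr_isolation_dichotomy.lean` ("hull
connectedness in functional form") says: along a continuous future-escaping outer path `γ`, at a scale `R` and levels
`a < b`, if the anchored Kerr window deviation `s ↦ kerrDev 𝒟 (γ s) R` is frequently `≤ a` and frequently `≥ b`, then it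
is frequently in the band `[a, b]`. This file proves the ORDER-THEORETIC content of S5 and isolates exactly which
regularity of `s ↦ kerrDev 𝒟 (γ s) R` it consumes (the companion file `…RKerrDevUpperSemicontinuity.lean` proves the
half of that regularity which is free: upper semicontinuity with scale loss).

§1 (`namespace HullIVT`, pure real-variable lemmas, any linearly ordered codomain `β`). The first time `t` at which a
function `f : ℝ → β` reaches a level `b` after being `< b` satisfies `f t = b` as soon as
(R-USC_b) `f t < b ⇒ f < b` on a right neighbourhood of `t` ("the superlevel set `{f ≥ b}` is closed under limits from
the right"), and (NUJ-L_b) `f < b` on a left neighbourhood of `t ⇒ f t ≤ b` ("no upward jump past `b` on ARRIVAL from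
the left") — `HullIVT.exists_eq_of_lt_of_le`; hence "frequently `< b` and frequently `≥ b` ⇒ frequently `= b`"
(`HullIVT.frequently_eq_of_frequently_lt_of_frequently_ge`), its order dual (first dropping time, levels `a`), the
continuous case (the intermediate value theorem in the form the skeleton wants, `HullIVT.frequently_mem_Icc_of_continuous`,
for `a ≤ b`), and the packaging by Mathlib's semicontinuity predicates: UPPER SEMICONTINUITY PLUS LOWER SEMICONTINUITY
FROM ONE SIDE (either side) suffices (`HullIVT.frequently_mem_Icc_of_usc_of_lscWithin_Iio/Ioi`). Minimality: a u.s.c. step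
function taking the value `1` on a closed half-line and `0` elsewhere crosses every band `0 < a < b < 1` without visiting
it, so u.s.c. alone is not enough; the two one-sided hypotheses of `exists_eq_of_lt_of_le` are each necessary for its
conclusion (drop (R-USC_b): `f = 𝟙_{(0,∞)}`; drop (NUJ-L_b): `f = 𝟙_{[0,∞)}`).

§2 (registered sub-goals of S5). `stub_hullConnectedness_of_continuous` — S5 verbatim with the extra hypothesis
`∀ R, Continuous fun s ↦ kerrDev 𝒟.toSpacetime (γ s) R` inserted after `IsFutureEscapingPath 𝒟 γ`;
`stub_hullConnectedness_of_oneSided` — S5 verbatim from (R-USC_b) and (NUJ-L_b) for `s ↦ kerrDev 𝒟 (γ s) R` at the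
given scale `R` and upper level `b` only; and the two semicontinuity packagings
(`hullConnectedness_of_usc_of_lscWithin_Iio/Ioi`). What is NOT free, and is NOT proved anywhere, is lower
semicontinuity of `s ↦ kerrDev 𝒟 (γ s) R` ("no upward jumps": equicontinuity of the inverses of near-optimal anchored
charts, i.e. compactness of near-optimal frames — the temporal-gauge content of Lorentzian Cheeger–Gromov theory,
Anderson 2004 §5); by §1 it is needed from ONE side only, and at fixed scale `R` upper semicontinuity is not free either
for the present open-window `kerrDev` (only with scale loss, companion file).

References: Hale 1980, Ch. I §8 (ω-limit sets of precompact orbits are connected — the dynamical reading of S5)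
[Hale1980]; Anderson 2004, §5 [Anderson2004]; the intermediate value theorem is Mathlib's order topology of `ℝ`
(`csInf`, one-sided neighbourhood filters `𝓝[<] t`, `𝓝[>] t`).
-/

noncomputable section

-- the operator-norm instance on `E4 →L[ℝ] E4 →L[ℝ] ℝ` needs one more level of pending
-- instance problems than the default (as in `PhotonSphereChannelsKerrDevDefs.lean`)
set_option maxSynthPendingDepth 3
-- every `Summit.FinalStateConjecture.FinalStateConjecture.…` name repeats the summit = sub-problem segment (D-0017 layout)
set_option linter.dupNamespace false

open Set Filter Function TopologicalSpace Manifold Bundle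
open scoped Topology Manifold ContDiff ENNReal NNReal

namespace Summit.FinalStateConjecture.FinalStateConjecture.Theorems

open Literature.Geometry.Lorentzian
open Summit.FinalStateConjecture.FinalStateConjecture.Theorems.TameHull

/-! ### §1 The real-variable shell: first hitting times, band visiting, one-sided regularity -/

namespace HullIVT

variable {β : Type*} [LinearOrder β]

/-- **First hitting time.** Let `f : ℝ → β` (any linear order `β`), `s₁ ≤ s₂`, `f s₁ < b ≤ f s₂`. Assume on
`[s₁, s₂]`: (R-USC_b) whenever `f t < b`, `f < b` on a right neighbourhood of `t`; (NUJ-L_b) whenever `f < b` on a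
left neighbourhood of `t`, `f t ≤ b`. Then `f t = b` for some `t ∈ [s₁, s₂]` — namely the infimum of
`{s ∈ [s₁, s₂] | b ≤ f s}`: (R-USC_b) puts it in the superlevel set, (NUJ-L_b) caps it by `b`. No topology on `β`.
[folklore] -/
theorem exists_eq_of_lt_of_le {f : ℝ → β} {s₁ s₂ : ℝ} {b : β} (h12 : s₁ ≤ s₂) (h1 : f s₁ < b)
    (h2 : b ≤ f s₂) (husc : ∀ t ∈ Icc s₁ s₂, f t < b → ∀ᶠ s in 𝓝[>] t, f s < b)
    (hnuj : ∀ t ∈ Icc s₁ s₂, (∀ᶠ s in 𝓝[<] t, f s < b) → f t ≤ b) :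
    ∃ t ∈ Icc s₁ s₂, f t = b := by
  set A : Set ℝ := {s | s ∈ Icc s₁ s₂ ∧ b ≤ f s} with hA
  have hs₂ : s₂ ∈ A := ⟨right_mem_Icc.2 h12, h2⟩
  have hne : A.Nonempty := ⟨s₂, hs₂⟩
  have hbdd : BddBelow A := ⟨s₁, fun s hs ↦ hs.1.1⟩
  set t : ℝ := sInf A with ht
  have ht₁ : s₁ ≤ t := le_csInf hne fun s hs ↦ hs.1.1
  have ht₂ : t ≤ s₂ := csInf_le hbdd hs₂
  have htI : t ∈ Icc s₁ s₂ := ⟨ht₁, ht₂⟩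
  -- (1) `b ≤ f t`: otherwise `f < b` just to the right of `t`, against points of `A` at or just above `t`
  have hge : b ≤ f t := by
    refine le_of_not_gt fun hlt ↦ ?_
    obtain ⟨u, hu, hsub⟩ := mem_nhdsGT_iff_exists_Ioo_subset.1 (husc t htI hlt)
    obtain ⟨s, hsA, hsu⟩ := exists_lt_of_csInf_lt hne (show sInf A < u from hu)
    rcases (show t ≤ s from csInf_le hbdd hsA).eq_or_lt with h | hts
    · exact absurd (by rw [h]; exact hsA.2) (not_le_of_gt hlt)
    · exact absurd hsA.2 (not_le_of_gt (hsub ⟨hts, hsu⟩))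
  -- hence `s₁ < t`
  have ht₁' : s₁ < t := lt_of_le_of_ne ht₁ fun h ↦ absurd (by rw [h]; exact hge) (not_le_of_gt h1)
  -- (2) `f t ≤ b`: `f < b` on `(s₁, t)`, whose points lie below the infimum of `A`
  have hle : f t ≤ b := by
    refine hnuj t htI ?_
    filter_upwards [Ioo_mem_nhdsLT ht₁'] with s hs
    refine lt_of_not_ge fun hbs ↦ ?_
    exact absurd hs.2 (not_lt_of_ge (csInf_le hbdd ⟨⟨hs.1.le, hs.2.le.trans ht₂⟩, hbs⟩))
  exact ⟨t, htI, le_antisymm hle hge⟩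

/-- **Band crossing upwards forces hitting the upper level, under one-sided regularity.** If `f : ℝ → β` satisfies
(R-USC_b) and (NUJ-L_b) at every time and is frequently `< b` and frequently `≥ b` at `+∞`, then it is frequently
`= b`. [folklore] -/
theorem frequently_eq_of_frequently_lt_of_frequently_ge {f : ℝ → β} {b : β}
    (husc : ∀ t, f t < b → ∀ᶠ s in 𝓝[>] t, f s < b)
    (hnuj : ∀ t, (∀ᶠ s in 𝓝[<] t, f s < b) → f t ≤ b)
    (hlt : ∃ᶠ s in atTop, f s < b) (hge : ∃ᶠ s in atTop, b ≤ f s) :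
    ∃ᶠ s in atTop, f s = b := by
  rw [frequently_atTop] at hlt hge ⊢
  intro N
  obtain ⟨s₁, hs₁, h1⟩ := hlt N
  obtain ⟨s₂, hs₂, h2⟩ := hge s₁
  obtain ⟨t, ht, hft⟩ :=
    exists_eq_of_lt_of_le hs₂ h1 h2 (fun t _ ↦ husc t) (fun t _ ↦ hnuj t)
  exact ⟨t, hs₁.trans ht.1, hft⟩

/-- **Order dual: band crossing downwards forces hitting the lower level**, under (R-LSC_a) `a < f t ⇒ a < f` on a
right neighbourhood of `t` and (NDJ-L_a) `a < f` on a left neighbourhood of `t ⇒ a ≤ f t` (no downward jump past `a`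
on arrival from the left). [folklore] -/
theorem frequently_eq_of_frequently_gt_of_frequently_le {f : ℝ → β} {a : β}
    (hlsc : ∀ t, a < f t → ∀ᶠ s in 𝓝[>] t, a < f s)
    (hndj : ∀ t, (∀ᶠ s in 𝓝[<] t, a < f s) → a ≤ f t)
    (hgt : ∃ᶠ s in atTop, a < f s) (hle : ∃ᶠ s in atTop, f s ≤ a) :
    ∃ᶠ s in atTop, f s = a :=
  frequently_eq_of_frequently_lt_of_frequently_ge (β := βᵒᵈ) (f := OrderDual.toDual ∘ f)
    (b := OrderDual.toDual a) hlsc hndj hgt hle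

/-- **Band visiting under one-sided regularity at the upper level** (the shape of stub S5): for `a < b`, (R-USC_b)
and (NUJ-L_b) everywhere, frequently `≤ a` and frequently `≥ b` imply frequently in `[a, b]` (indeed frequently
`= b`). [folklore] -/
theorem frequently_mem_Icc_of_oneSided {f : ℝ → β} {a b : β} (hab : a < b)
    (husc : ∀ t, f t < b → ∀ᶠ s in 𝓝[>] t, f s < b)
    (hnuj : ∀ t, (∀ᶠ s in 𝓝[<] t, f s < b) → f t ≤ b)
    (hle : ∃ᶠ s in atTop, f s ≤ a) (hge : ∃ᶠ s in atTop, b ≤ f s) :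
    ∃ᶠ s in atTop, a ≤ f s ∧ f s ≤ b :=
  (frequently_eq_of_frequently_lt_of_frequently_ge husc hnuj (hle.mono fun _ hs ↦ hs.trans_lt hab) hge).mono
    fun _ hs ↦ ⟨hab.le.trans hs.ge, hs.le⟩

/-- **Band visiting under one-sided regularity at the lower level** (order dual): for `a < b`, (R-LSC_a) and
(NDJ-L_a) everywhere, frequently `≤ a` and frequently `≥ b` imply frequently in `[a, b]` (indeed frequently `= a`).
[folklore] -/
theorem frequently_mem_Icc_of_oneSided' {f : ℝ → β} {a b : β} (hab : a < b)
    (hlsc : ∀ t, a < f t → ∀ᶠ s in 𝓝[>] t, a < f s)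
    (hndj : ∀ t, (∀ᶠ s in 𝓝[<] t, a < f s) → a ≤ f t)
    (hle : ∃ᶠ s in atTop, f s ≤ a) (hge : ∃ᶠ s in atTop, b ≤ f s) :
    ∃ᶠ s in atTop, a ≤ f s ∧ f s ≤ b :=
  (frequently_eq_of_frequently_gt_of_frequently_le hlsc hndj (hge.mono fun _ hs ↦ hab.trans_le hs) hle).mono
    fun _ hs ↦ ⟨hs.ge, hs.le.trans hab.le⟩

/-- **Upper semicontinuity plus lower semicontinuity FROM THE LEFT suffice**: (R-USC_b) is upper semicontinuity
(from the right) and (NUJ-L_b) follows from lower semicontinuity within `(-∞, t)` at every `t`. [folklore] -/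
theorem frequently_mem_Icc_of_usc_of_lscWithin_Iio {f : ℝ → β} (husc : UpperSemicontinuous f)
    (hlsc : ∀ t, LowerSemicontinuousWithinAt f (Iio t) t) {a b : β} (hab : a < b)
    (hle : ∃ᶠ s in atTop, f s ≤ a) (hge : ∃ᶠ s in atTop, b ≤ f s) :
    ∃ᶠ s in atTop, a ≤ f s ∧ f s ≤ b :=
  frequently_mem_Icc_of_oneSided hab
    (fun t hb ↦ (upperSemicontinuousAt_iff.1 (husc t) b hb).filter_mono nhdsWithin_le_nhds)
    (fun t h ↦ le_of_not_gt fun hbt ↦ by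
      obtain ⟨s, hs₁, hs₂⟩ := (h.and (lowerSemicontinuousWithinAt_iff.1 (hlsc t) b hbt)).exists
      exact lt_asymm hs₁ hs₂)
    hle hge

/-- **Upper semicontinuity plus lower semicontinuity FROM THE RIGHT suffice** (dual route: first dropping time to
the level `a`; (R-LSC_a) is lower semicontinuity within `(t, ∞)`, (NDJ-L_a) follows from upper semicontinuity).
Together with `frequently_mem_Icc_of_usc_of_lscWithin_Iio`: given upper semicontinuity, lower semicontinuity from
EITHER side is enough for band visiting. [folklore] -/
theorem frequently_mem_Icc_of_usc_of_lscWithin_Ioi {f : ℝ → β} (husc : UpperSemicontinuous f)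
    (hlsc : ∀ t, LowerSemicontinuousWithinAt f (Ioi t) t) {a b : β} (hab : a < b)
    (hle : ∃ᶠ s in atTop, f s ≤ a) (hge : ∃ᶠ s in atTop, b ≤ f s) :
    ∃ᶠ s in atTop, a ≤ f s ∧ f s ≤ b :=
  frequently_mem_Icc_of_oneSided' hab
    (fun t ha ↦ lowerSemicontinuousWithinAt_iff.1 (hlsc t) a ha)
    (fun t h ↦ le_of_not_gt fun hat ↦ by
      obtain ⟨s, hs₁, hs₂⟩ :=
        (h.and ((upperSemicontinuousAt_iff.1 (husc t) a hat).filter_mono nhdsWithin_le_nhds)).exists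
      exact lt_asymm hs₁ hs₂)
    hle hge

variable [TopologicalSpace β] [OrderClosedTopology β]

/-- **The continuous case** (intermediate value theorem, `+∞`-frequently form): a continuous `f : ℝ → β` which is
frequently `< b` and frequently `≥ b` is frequently `= b`. [folklore] -/
theorem frequently_eq_of_continuous {f : ℝ → β} (hf : Continuous f) {b : β}
    (hlt : ∃ᶠ s in atTop, f s < b) (hge : ∃ᶠ s in atTop, b ≤ f s) : ∃ᶠ s in atTop, f s = b :=
  frequently_eq_of_frequently_lt_of_frequently_ge
    (fun t ht ↦ ((hf.tendsto t).eventually (eventually_lt_nhds ht)).filter_mono nhdsWithin_le_nhds)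
    (fun t ht ↦ le_of_tendsto ((hf.tendsto t).mono_left nhdsWithin_le_nhds) (ht.mono fun _ hs ↦ hs.le))
    hlt hge

/-- **Band visiting for continuous functions** (the form stub S5 takes under continuity of
`s ↦ kerrDev 𝒟 (γ s) R`; levels `a ≤ b` in any linear order with order-closed topology, e.g. `ℝ≥0∞`): frequently
`≤ a` and frequently `≥ b` imply frequently in `[a, b]`. [folklore] -/
theorem frequently_mem_Icc_of_continuous {f : ℝ → β} (hf : Continuous f) {a b : β} (hab : a ≤ b)
    (hle : ∃ᶠ s in atTop, f s ≤ a) (hge : ∃ᶠ s in atTop, b ≤ f s) :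
    ∃ᶠ s in atTop, a ≤ f s ∧ f s ≤ b := by
  by_cases heq : ∃ᶠ s in atTop, f s = b
  · exact heq.mono fun _ hs ↦ ⟨hab.trans hs.ge, hs.le⟩
  · have hne : ∀ᶠ s in atTop, f s ≠ b := not_frequently.1 heq
    have hlt : ∃ᶠ s in atTop, f s < b :=
      (hle.and_eventually hne).mono fun _ hs ↦ lt_of_le_of_ne (hs.1.trans hab) hs.2
    exact absurd (frequently_eq_of_continuous hf hlt hge) heq

end HullIVT

/-! ### §2 Stub S5 from regularity of `s ↦ kerrDev 𝒟 (γ s) R` (registered sub-goals of `stub_hullConnectedness`) -/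

/-- **Registered sub-goal `stub_hullConnectedness_of_continuous` of S5.** Stub S5 (`HullConnectedness`, verbatim)
under the extra hypothesis that the anchored Kerr window deviation is CONTINUOUS along the path at every scale
(inserted after `IsFutureEscapingPath 𝒟 γ`): the intermediate value theorem in `ℝ≥0∞`
(`HullIVT.frequently_mem_Icc_of_continuous`). The remaining content of S5 is thus exactly the regularity of
`s ↦ kerrDev 𝒟 (γ s) R`; by `stub_hullConnectedness_of_oneSided` much less than continuity is consumed.
[cite: Hale1980, Ch. I §8 Thm. 8.1] -/
theorem stub_hullConnectedness_of_continuous :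
    ∀ (X : Type) [TopologicalSpace X] [ChartedSpace E3 X] [IsManifold (𝓡 3) ∞ X] [T2Space X]
      [SecondCountableTopology X] [ConnectedSpace X], ∀ D ∈ admissibleVacuumData X,
      ∀ (𝒟 : VacuumCauchyDevelopment D) [𝒟.metric.HasLeviCivita], DevHyp 𝒟 →
        ∀ γ : ℝ → 𝒟.carrier, Continuous γ → IsFutureEscapingPath 𝒟 γ →
          (∀ R : ℝ, Continuous fun s ↦ kerrDev 𝒟.toSpacetime (γ s) R) →
          ∀ (R : ℝ) (a b : ℝ≥0∞), a < b →
            (∃ᶠ s in atTop, kerrDev 𝒟.toSpacetime (γ s) R ≤ a) →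
              (∃ᶠ s in atTop, b ≤ kerrDev 𝒟.toSpacetime (γ s) R) →
                ∃ᶠ s in atTop, a ≤ kerrDev 𝒟.toSpacetime (γ s) R ∧
                  kerrDev 𝒟.toSpacetime (γ s) R ≤ b := by
  intro X _ _ _ _ _ _ D _ 𝒟 _ _ γ _ _ hcont R a b hab hle hge
  exact HullIVT.frequently_mem_Icc_of_continuous (hcont R) hab.le hle hge

/-- **Registered sub-goal `stub_hullConnectedness_of_oneSided` of S5 — the minimal regularity the IVT step
consumes.** Stub S5 at scale `R` and levels `a < b` follows from two ONE-SIDED properties of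
`F := fun s ↦ kerrDev 𝒟 (γ s) R` at the single level `b`: (R-USC_b) `F t < b ⇒ F < b` just after `t` (the
superlevel set `{F ≥ b}` is closed under limits from the right — upper semicontinuity from the right at level `b`),
and (NUJ-L_b) `F < b` just before `t ⇒ F t ≤ b` (no upward jump past `b` on arrival from the left — a weak lower
semicontinuity from the left at level `b`). Then `F` even EQUALS `b` frequently (first hitting times,
`HullIVT.exists_eq_of_lt_of_le`). Neither hypothesis comes for free for the present `kerrDev` (open, non-extendable
windows) — what is proved is (R-USC) with scale loss (`stub_kerrDev_usc_scaleLoss` of the companion file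
`…RKerrDevUpperSemicontinuity.lean`). [cite: Hale1980, Ch. I §8 Thm. 8.1] -/
theorem stub_hullConnectedness_of_oneSided :
    ∀ (X : Type) [TopologicalSpace X] [ChartedSpace E3 X] [IsManifold (𝓡 3) ∞ X] [T2Space X]
      [SecondCountableTopology X] [ConnectedSpace X], ∀ D ∈ admissibleVacuumData X,
      ∀ (𝒟 : VacuumCauchyDevelopment D) [𝒟.metric.HasLeviCivita], DevHyp 𝒟 →
        ∀ γ : ℝ → 𝒟.carrier, Continuous γ → IsFutureEscapingPath 𝒟 γ →
          ∀ (R : ℝ) (a b : ℝ≥0∞), a < b →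
            (∀ t : ℝ, kerrDev 𝒟.toSpacetime (γ t) R < b →
              ∀ᶠ s in 𝓝[>] t, kerrDev 𝒟.toSpacetime (γ s) R < b) →
            (∀ t : ℝ, (∀ᶠ s in 𝓝[<] t, kerrDev 𝒟.toSpacetime (γ s) R < b) →
              kerrDev 𝒟.toSpacetime (γ t) R ≤ b) →
            (∃ᶠ s in atTop, kerrDev 𝒟.toSpacetime (γ s) R ≤ a) →
              (∃ᶠ s in atTop, b ≤ kerrDev 𝒟.toSpacetime (γ s) R) →
                ∃ᶠ s in atTop, a ≤ kerrDev 𝒟.toSpacetime (γ s) R ∧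
                  kerrDev 𝒟.toSpacetime (γ s) R ≤ b := by
  intro X _ _ _ _ _ _ D _ 𝒟 _ _ γ _ _ R a b hab husc hnuj hle hge
  exact HullIVT.frequently_mem_Icc_of_oneSided hab husc hnuj hle hge

/-- **S5 from upper semicontinuity plus lower semicontinuity from the left** of `s ↦ kerrDev 𝒟 (γ s) R` (at the
scale in question). [cite: Hale1980, Ch. I §8 Thm. 8.1] -/
theorem hullConnectedness_of_usc_of_lscWithin_Iio :
    ∀ (X : Type) [TopologicalSpace X] [ChartedSpace E3 X] [IsManifold (𝓡 3) ∞ X] [T2Space X]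
      [SecondCountableTopology X] [ConnectedSpace X], ∀ D ∈ admissibleVacuumData X,
      ∀ (𝒟 : VacuumCauchyDevelopment D) [𝒟.metric.HasLeviCivita], DevHyp 𝒟 →
        ∀ γ : ℝ → 𝒟.carrier, Continuous γ → IsFutureEscapingPath 𝒟 γ → ∀ (R : ℝ),
          UpperSemicontinuous (fun s ↦ kerrDev 𝒟.toSpacetime (γ s) R) →
          (∀ t : ℝ, LowerSemicontinuousWithinAt (fun s ↦ kerrDev 𝒟.toSpacetime (γ s) R) (Iio t) t) →
          ∀ (a b : ℝ≥0∞), a < b →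
            (∃ᶠ s in atTop, kerrDev 𝒟.toSpacetime (γ s) R ≤ a) →
              (∃ᶠ s in atTop, b ≤ kerrDev 𝒟.toSpacetime (γ s) R) →
                ∃ᶠ s in atTop, a ≤ kerrDev 𝒟.toSpacetime (γ s) R ∧
                  kerrDev 𝒟.toSpacetime (γ s) R ≤ b := by
  intro X _ _ _ _ _ _ D _ 𝒟 _ _ γ _ _ R husc hlsc a b hab hle hge
  exact HullIVT.frequently_mem_Icc_of_usc_of_lscWithin_Iio husc hlsc hab hle hge

/-- **S5 from upper semicontinuity plus lower semicontinuity from the right** of `s ↦ kerrDev 𝒟 (γ s) R` (at the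
scale in question): given upper semicontinuity, lower semicontinuity from either side suffices.
[cite: Hale1980, Ch. I §8 Thm. 8.1] -/
theorem hullConnectedness_of_usc_of_lscWithin_Ioi :
    ∀ (X : Type) [TopologicalSpace X] [ChartedSpace E3 X] [IsManifold (𝓡 3) ∞ X] [T2Space X]
      [SecondCountableTopology X] [ConnectedSpace X], ∀ D ∈ admissibleVacuumData X,
      ∀ (𝒟 : VacuumCauchyDevelopment D) [𝒟.metric.HasLeviCivita], DevHyp 𝒟 →
        ∀ γ : ℝ → 𝒟.carrier, Continuous γ → IsFutureEscapingPath 𝒟 γ → ∀ (R : ℝ),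
          UpperSemicontinuous (fun s ↦ kerrDev 𝒟.toSpacetime (γ s) R) →
          (∀ t : ℝ, LowerSemicontinuousWithinAt (fun s ↦ kerrDev 𝒟.toSpacetime (γ s) R) (Ioi t) t) →
          ∀ (a b : ℝ≥0∞), a < b →
            (∃ᶠ s in atTop, kerrDev 𝒟.toSpacetime (γ s) R ≤ a) →
              (∃ᶠ s in atTop, b ≤ kerrDev 𝒟.toSpacetime (γ s) R) →
                ∃ᶠ s in atTop, a ≤ kerrDev 𝒟.toSpacetime (γ s) R ∧
                  kerrDev 𝒟.toSpacetime (γ s) R ≤ b := by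
  intro X _ _ _ _ _ _ D _ 𝒟 _ _ γ _ _ R husc hlsc a b hab hle hge
  exact HullIVT.frequently_mem_Icc_of_usc_of_lscWithin_Ioi husc hlsc hab hle hge

end Summit.FinalStateConjecture.FinalStateConjecture.Theorems

end
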